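import Mathlib
import Literature.AlgebraicGeometry.Resolution.CompositeValuations
import HarnessLib

/-!
# Independence of monomial values modulo `p`-th powers descends to the residue valuation ring
# (crux `IndSmooth.ValuativeSmoothing`, stmt-ResolutionOfSingularities-16087, line `birth`,
# lead c1 devissage programme "discrete jumps", wave 2: stub E2 `valuation_monomial_ne_residue`)

Setting: `O ≤ O₁` are valuation rings of a field `K` (a composite valuation `ν_O = ν_{O₁} ∘ ν̄`),
`W̄ := residueValuationSubring O O₁ hle ⊆ κ(O₁)` is the residue valuation ring (the image
`O / 𝔪_{O₁}` of `O` in the residue field `κ(O₁) = IsLocalRing.ResidueField O₁`), and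
`a : ι → K` is a finite family of UNITS of `O₁` (`a i ∈ O₁`, `(a i)⁻¹ ∈ O₁`).

What is proved (`valuation_monomial_ne_residue`): if the `O`-values of the monomials
`∏ i, a i ^ α i` with exponents `α : ι → Fin p` are pairwise incongruent modulo values of `p`-th
powers (`O.valuation (a^α) ≠ O.valuation (h ^ p * a^β)` for `α ≠ β` and every `h : K`), then the
same holds for the residues `ā i := residue O₁ ⟨a i, _⟩` with respect to `W̄`:
`W̄.valuation (ā^α) ≠ W̄.valuation (h̄ ^ p * ā^β)` for every `h̄ : κ(O₁)`.

Proof: suppose `W̄.valuation (ā^α) = W̄.valuation (h̄ ^ p * ā^β)`. From `hind` with `h = 0` the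
monomials `a^α`, `a^β` are nonzero, hence units of `O₁`, so `ā^α = residue (a^α) ≠ 0`; thus
`h̄ ≠ 0`, and a lift `h₀ : O₁` of `h̄` is a unit of `O₁`. Put `x := a^α`, `z := h₀ ^ p * a^β`, two
units of `O₁` with `W̄.valuation (residue x) = W̄.valuation (residue z)`. Equal `W̄`-values of
nonzero residues mean `residue (x / z) ∈ W̄` and `residue (z / x) ∈ W̄`, i.e. (the residue of
`y : O₁` lies in `W̄` iff `y ∈ O`, tree lemma `residue_mem_residueValuationSubring_iff`)
`x / z ∈ O` and `z / x ∈ O`, whence `O.valuation x = O.valuation z` — contradicting `hind α β h₀`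
(`valuation_eq_of_residue_valuation_eq`).

Sources: folklore on composite valuations (Zariski–Samuel II, Ch. VI § 10; Novacoski–Spivakovsky
2014, § 2.1). Design: everything is phrased with elements of `K` and membership proofs, matching
the registered signature; the two one-line valuation-ring facts `valuation_le_of_div_mem`,
`div_mem_of_valuation_eq` are kept as separate lemmas. Not here: the converse direction and the
production of `hind` from a chain of overrings (neighbouring stubs of the same line).
-/

-- single-problem summit: the doubled namespace component is forced
set_option linter.dupNamespace false

open scoped TensorProduct

namespace Summit.ResolutionOfSingularities.ResolutionOfSingularities.Theorems.ValuativeSmoothing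

open IsLocalRing Literature.AlgebraicGeometry.Resolution

/-- If `u / w` lies in a valuation ring `S` of a field (`w ≠ 0`), then
`S.valuation u ≤ S.valuation w`. [folklore] -/
theorem valuation_le_of_div_mem {F : Type*} [Field F] (S : ValuationSubring F) {u w : F}
    (hw : w ≠ 0) (h : u / w ∈ S) : S.valuation u ≤ S.valuation w := by
  have h1 : S.valuation (u / w) ≤ 1 := (S.valuation_le_one_iff _).mpr h
  calc S.valuation u = S.valuation (u / w * w) := by rw [div_mul_cancel₀ u hw]
    _ = S.valuation (u / w) * S.valuation w := map_mul _ _ _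
    _ ≤ 1 * S.valuation w := mul_le_mul_left h1 _
    _ = S.valuation w := one_mul _

/-- Elements of equal value (the second nonzero) have their quotient in the valuation ring.
[folklore] -/
theorem div_mem_of_valuation_eq {F : Type*} [Field F] (S : ValuationSubring F) {u w : F}
    (hw : w ≠ 0) (h : S.valuation u = S.valuation w) : u / w ∈ S := by
  rw [← S.valuation_le_one_iff, map_div₀, h, div_self ((Valuation.ne_zero_iff _).mpr hw)]

/-- An element of `O₁` with inverse in `O₁` is either `0` or has nonzero residue. [folklore] -/
theorem residue_mk_ne_zero {K : Type*} [Field K] (O₁ : ValuationSubring K) {x : K}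
    (hx : x ∈ O₁) (hxi : x⁻¹ ∈ O₁) (hx0 : x ≠ 0) : residue O₁ ⟨x, hx⟩ ≠ 0 :=
  (residue_ne_zero_iff_isUnit _).mpr (isUnit_of_inv_mem O₁ hx hxi hx0)

/-- The residue of a quotient `x / y` of units of `O₁` (given by membership of `x, y, y⁻¹`) is
the quotient of the residues. [folklore] -/
theorem residue_mk_div {K : Type*} [Field K] (O₁ : ValuationSubring K) {x y : K}
    (hx : x ∈ O₁) (hy : y ∈ O₁) (hyi : y⁻¹ ∈ O₁) (hy0 : y ≠ 0) :
    residue O₁ ⟨x / y, div_eq_mul_inv x y ▸ mul_mem hx hyi⟩ =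
      residue O₁ ⟨x, hx⟩ / residue O₁ ⟨y, hy⟩ := by
  rw [div_eq_mul_inv (residue O₁ _), ← residue_mk_inv O₁ hy hyi hy0, ← map_mul]
  congr 1
  exact Subtype.ext (div_eq_mul_inv x y)

/-- KEY transfer lemma of a composite valuation `ν_O = ν_{O₁} ∘ ν̄`: two units `x, y` of `O₁`
whose residues have the same `ν̄`-value (`W̄ = O / 𝔪_{O₁}`-value) have the same `ν_O`-value.
Indeed `residue (x / y)` and `residue (y / x)` lie in `W̄`, so `x / y, y / x ∈ O`. [folklore] -/
theorem valuation_eq_of_residue_valuation_eq {K : Type*} [Field K] (O O₁ : ValuationSubring K)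
    (hle : O ≤ O₁) {x y : K} (hx : x ∈ O₁) (hxi : x⁻¹ ∈ O₁) (hx0 : x ≠ 0) (hy : y ∈ O₁)
    (hyi : y⁻¹ ∈ O₁) (hy0 : y ≠ 0)
    (h : (residueValuationSubring O O₁ hle).valuation (residue O₁ ⟨x, hx⟩) =
      (residueValuationSubring O O₁ hle).valuation (residue O₁ ⟨y, hy⟩)) :
    O.valuation x = O.valuation y := by
  have hxr : residue O₁ ⟨x, hx⟩ ≠ 0 := residue_mk_ne_zero O₁ hx hxi hx0
  have hyr : residue O₁ ⟨y, hy⟩ ≠ 0 := residue_mk_ne_zero O₁ hy hyi hy0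
  -- `residue (x / y) ∈ W̄` and `residue (y / x) ∈ W̄`
  have hxy := div_mem_of_valuation_eq (residueValuationSubring O O₁ hle) hyr h
  have hyx := div_mem_of_valuation_eq (residueValuationSubring O O₁ hle) hxr h.symm
  rw [← residue_mk_div O₁ hx hy hyi hy0, residue_mem_residueValuationSubring_iff] at hxy
  rw [← residue_mk_div O₁ hy hx hxi hx0, residue_mem_residueValuationSubring_iff] at hyx
  -- hence `x / y ∈ O` and `y / x ∈ O`
  exact le_antisymm (valuation_le_of_div_mem O hy0 hxy) (valuation_le_of_div_mem O hx0 hyx)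

/-- A finite product of powers of elements of `O₁` whose inverses lie in `O₁` has its inverse in
`O₁`. [folklore] -/
theorem inv_prod_pow_mem {K : Type*} [Field K] (O₁ : ValuationSubring K) {ι : Type*}
    [Fintype ι] (a : ι → K) (hai : ∀ i, (a i)⁻¹ ∈ O₁) (n : ι → ℕ) :
    (∏ i, a i ^ n i)⁻¹ ∈ O₁ := by
  rw [← Finset.prod_inv_distrib]
  simp_rw [← inv_pow]
  exact prod_mem fun i _ => pow_mem (hai i) _

/-- The residue of a monomial in elements of `O₁` is the monomial in the residues. [folklore] -/
theorem residue_mk_prod_pow {K : Type*} [Field K] (O₁ : ValuationSubring K) {ι : Type*}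
    [Fintype ι] (a : ι → K) (ha : ∀ i, a i ∈ O₁) (n : ι → ℕ) :
    residue O₁ ⟨∏ i, a i ^ n i, prod_mem fun i _ => pow_mem (ha i) _⟩ =
      ∏ i, residue O₁ ⟨a i, ha i⟩ ^ n i := by
  simp_rw [← map_pow, ← map_prod]
  congr 1
  apply Subtype.ext
  push_cast
  rfl

/-- Stub E2: valuation independence modulo `p`-th powers descends to the residue field of a
coarsening. -/
theorem valuation_monomial_ne_residue (p : ℕ) (K : Type) [Field K]
    (O O₁ : ValuationSubring K) (hle : O ≤ O₁) {ι : Type} [Fintype ι] (a : ι → K)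
    (ha : ∀ i, a i ∈ O₁) (hai : ∀ i, (a i)⁻¹ ∈ O₁)
    (hind : ∀ α β : ι → Fin p, α ≠ β → ∀ h : K,
      O.valuation (∏ i, a i ^ (α i : ℕ)) ≠ O.valuation (h ^ p * ∏ i, a i ^ (β i : ℕ)))
    (α β : ι → Fin p) (hαβ : α ≠ β) (h : IsLocalRing.ResidueField O₁) :
    (Literature.AlgebraicGeometry.Resolution.residueValuationSubring O O₁ hle).valuation
        (∏ i, IsLocalRing.residue O₁ ⟨a i, ha i⟩ ^ (α i : ℕ)) ≠
      (Literature.AlgebraicGeometry.Resolution.residueValuationSubring O O₁ hle).valuation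
        (h ^ p * ∏ i, IsLocalRing.residue O₁ ⟨a i, ha i⟩ ^ (β i : ℕ)) := by
  -- `p = 0` is vacuous: `Fin 0` is empty, so `α = β`
  rcases Nat.eq_zero_or_pos p with rfl | hp
  · exact absurd (funext fun i => (α i).elim0) hαβ
  intro heq
  -- the monomials upstairs: members of `O₁` with inverses in `O₁`, nonzero by `hind` at `h = 0`
  set x : K := ∏ i, a i ^ (α i : ℕ)
  set y : K := ∏ i, a i ^ (β i : ℕ)
  have hx : x ∈ O₁ := prod_mem fun i _ => pow_mem (ha i) _
  have hy : y ∈ O₁ := prod_mem fun i _ => pow_mem (ha i) _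
  have hxi : x⁻¹ ∈ O₁ := inv_prod_pow_mem O₁ a hai _
  have hyi : y⁻¹ ∈ O₁ := inv_prod_pow_mem O₁ a hai _
  have hx0 : x ≠ 0 := by
    have := hind α β hαβ 0
    rw [zero_pow hp.ne', zero_mul, map_zero] at this
    exact (Valuation.ne_zero_iff _).mp this
  have hy0 : y ≠ 0 := by
    have := hind β α hαβ.symm 0
    rw [zero_pow hp.ne', zero_mul, map_zero] at this
    exact (Valuation.ne_zero_iff _).mp this
  have hxres : ∏ i, residue O₁ ⟨a i, ha i⟩ ^ (α i : ℕ) = residue O₁ ⟨x, hx⟩ :=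
    (residue_mk_prod_pow O₁ a ha _).symm
  have hyres : ∏ i, residue O₁ ⟨a i, ha i⟩ ^ (β i : ℕ) = residue O₁ ⟨y, hy⟩ :=
    (residue_mk_prod_pow O₁ a ha _).symm
  rw [hxres, hyres] at heq
  -- the left-hand side is nonzero, hence so is `h`; lift it to a unit `h₀` of `O₁`
  have hxr : residue O₁ ⟨x, hx⟩ ≠ 0 := residue_mk_ne_zero O₁ hx hxi hx0
  have hh0 : h ≠ 0 := by
    rintro rfl
    rw [zero_pow hp.ne', zero_mul, map_zero] at heq
    exact (Valuation.ne_zero_iff _).mpr hxr heq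
  obtain ⟨h₀, rfl⟩ := residue_surjective h
  have hu : IsUnit h₀ := (residue_ne_zero_iff_isUnit _).mp hh0
  have hh₀i : (h₀ : K)⁻¹ ∈ O₁ := inv_mem_of_isUnit O₁ h₀.2 (by simpa using hu)
  have hh₀0 : (h₀ : K) ≠ 0 := by
    rintro e
    apply hh0
    have : h₀ = 0 := Subtype.ext e
    rw [this, map_zero]
  -- `z := h₀ ^ p * y`, again a unit of `O₁`, with residue the right-hand argument
  set z : K := (h₀ : K) ^ p * y with hzdef
  have hz : z ∈ O₁ := mul_mem (pow_mem h₀.2 _) hy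
  have hzi : z⁻¹ ∈ O₁ := by
    rw [hzdef, mul_inv, ← inv_pow]
    exact mul_mem (pow_mem hh₀i _) hyi
  have hz0 : z ≠ 0 := mul_ne_zero (pow_ne_zero _ hh₀0) hy0
  have hzres : residue O₁ h₀ ^ p * residue O₁ ⟨y, hy⟩ = residue O₁ ⟨z, hz⟩ := by
    rw [← map_pow, ← map_mul]
    congr 1
  rw [hzres] at heq
  -- transfer down to `O` and contradict `hind`
  exact hind α β hαβ (h₀ : K)
    (valuation_eq_of_residue_valuation_eq O O₁ hle hx hxi hx0 hz hzi hz0 heq)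

end Summit.ResolutionOfSingularities.ResolutionOfSingularities.Theorems.ValuativeSmoothing
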